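import Mathlib
import Summits.Ventures.PercRepro2.AS3Corr

/-!
# (AS3) when every disjoint pair of `B`-members passes through one member (the «star» case)
(seat mine-b, cell pub-perc-repro2; conjectures/MINE-B.md §16.4)

`Φ = R + c` (AS3Corr.lean): (AS3) holds as soon as the correction
`c = #{A □ B at γ ∧ ρ ∈ B} − #{B □ B at γ ∧ ρ ∈ A}` is non-negative.  Here `c ≥ 0` is proved by an
explicit injection from the second count into the first whenever some `B`-member `W₁` lies in every
disjoint occurrence of `B` with itself: `B □ B at γ ⟹ W₁ ⊆ γ ∧ B (γ \ W₁)` (`StarMember`).  The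
injection is the MONOTONE RELAY «complement the colouring and hand `W₁` back to blue»:
`γ ↦ (U \ γ) ∪ W₁` — the new blue side contains the old red side (in `A`) and `W₁` (in `B`), disjointly,
and the new red side `γ \ W₁` is in `B`; `γ` is recovered as `(U \ image) ∪ W₁`.

Census (MINE-B.md §16.4): among the up-sets `B` on 4 / 5 elements whose disjointness graph (minimal
members, adjacent iff disjoint) has NO two disjoint edges, `c ≥ 0` for every `A` (155 / 155 and
5,210 / 5,210); such graphs are exactly the stars (this file) and the triangles (three pairwise disjoint
members — (AS3) there is `AS3_of_pairwiseDisjoint`).  With a 2-matching `c < 0` occurs (1 / 11 and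
56 / 2,369 such `B`), and (AS3) is genuinely beyond Reimer's inequality only there.
-/

open Finset

namespace Summit.Ventures.PercRepro2

namespace StepZero

open ReimerCube

variable {E : Type*} [DecidableEq E]

open Classical

/-- `W₁` is a star member of `B` on `U`: `W₁` generates members of `B`, and every disjoint occurrence of
`B` with itself inside `U` consists of `W₁` and a member of `B` disjoint from it. -/
def StarMember (U : Finset E) (B : Finset E → Prop) (W₁ : Finset E) : Prop :=
  (∀ T, W₁ ⊆ T → B T) ∧ ∀ γ ⊆ U, DOcc B B γ → W₁ ⊆ γ ∧ B (γ \ W₁)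

/-- **The star injection**: `#{B □ B at γ ∧ ρ ∈ A} ≤ #{A □ B at γ ∧ ρ ∈ B}` when `B` has a star member. -/
theorem cM_le_cX_of_starMember (U : Finset E) {A : Finset E → Prop} (hA : Incr A) (B : Finset E → Prop)
    {W₁ : Finset E} (hW : StarMember U B W₁) : cM U A B ≤ cX U A B := by
  unfold cM cX
  apply Finset.card_le_card_of_injOn (fun γ => (U \ γ) ∪ W₁)
  · intro γ hγ
    rw [Finset.mem_coe, Finset.mem_filter, Finset.mem_powerset] at hγ ⊢
    obtain ⟨hγU, hBB, hAρ⟩ := hγ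
    obtain ⟨hW₁γ, hBrest⟩ := hW.2 γ hγU hBB
    refine ⟨?_, ?_, ?_⟩
    · exact Finset.union_subset Finset.sdiff_subset (hW₁γ.trans hγU)
    · refine ⟨U \ γ, W₁, Finset.subset_union_left, Finset.subset_union_right, ?_, ?_, hW.1⟩
      · rw [Finset.disjoint_left]
        intro x hx hxW
        exact (Finset.mem_sdiff.mp hx).2 (hW₁γ hxW)
      · intro T hT
        exact hA hT hAρ
    · have e : U \ ((U \ γ) ∪ W₁) = γ \ W₁ := by
        ext x
        simp only [Finset.mem_sdiff, Finset.mem_union, not_or, not_and, not_not]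
        constructor
        · rintro ⟨hxU, h1, h2⟩
          exact ⟨h1 hxU, h2⟩
        · rintro ⟨hxγ, hxW⟩
          exact ⟨hγU hxγ, fun _ => hxγ, hxW⟩
      rw [e]
      exact hBrest
  · intro γ hγ γ' hγ' h
    rw [Finset.mem_coe, Finset.mem_filter, Finset.mem_powerset] at hγ hγ'
    have hW₁γ := (hW.2 γ hγ.1 hγ.2.1).1
    have hW₁γ' := (hW.2 γ' hγ'.1 hγ'.2.1).1
    have key : ∀ δ ⊆ U, W₁ ⊆ δ → U \ ((U \ δ) ∪ W₁) ∪ W₁ = δ := by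
      intro δ hδ hWδ
      ext x
      simp only [Finset.mem_union, Finset.mem_sdiff, not_or, not_and, not_not]
      constructor
      · rintro (⟨hxU, h1, -⟩ | hxW)
        · exact h1 hxU
        · exact hWδ hxW
      · intro hxδ
        by_cases hxW : x ∈ W₁
        · exact Or.inr hxW
        · exact Or.inl ⟨hδ hxδ, fun _ => hxδ, hxW⟩
    have := congrArg (fun S => U \ S ∪ W₁) h
    simp only at this
    rw [key γ hγ.1 hW₁γ, key γ' hγ'.1 hW₁γ'] at this
    exact this

/-- **(AS3) in the star case**: `c ≥ 0`, hence (AS3), when `B` has a star member. -/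
theorem AS3_of_starMember (U : Finset E) {A B : Finset E → Prop} (hA : Incr A) (hB : Incr B)
    {W₁ : Finset E} (hW : StarMember U B W₁) : AS3 U A B := by
  apply AS3_of_corr_nonneg U hA hB
  unfold corr
  have := cM_le_cX_of_starMember U hA B hW
  omega

end StepZero

end Summit.Ventures.PercRepro2
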